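import Literature.Analysis.FluidPDE.NSCriticalClosureTao
import Literature.Analysis.FluidPDE.NSLocalClassical
import HarnessLib

/-!
# Corollaries of Tao's smooth `H¹` local existence theorem

Analysis/FluidPDE proof file for the named fact `NS.tao2011_smooth_local_existence`
(`TaoH1LocalExistence.lean`; Tao 2013, Thm. 5.4 (ii)+(iv)). It records that this fact implies the
named fact `Fluid.local_classical_lerayHopf` (`NSLocalClassical.lean`: for `ν > 0` and a smooth,
divergence-free, rapidly decaying datum there are `T > 0` and a classical solution on `[0, T)`
with `u(0) = u₀` which is Leray–Hopf on `[0, T]`): a Schwartz datum is in `H^∞`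
(`HasRapidSpatialDecay.lintegral_enorm_iteratedFDeriv_sq_lt_top`), so Tao's theorem applies on
`[0, T]` for `T = c ν³ / (‖u₀‖⁴_{H¹} + 1)`, and the resulting smooth solution with bounded Sobolev
norms is Leray–Hopf (`NS.isLerayHopfOn_of_hasBoundedSobolevNormsOn`, `NSCriticalClosureTao.lean`).

## References

* T. Tao, Anal. PDE 6 (2013) = arXiv:1108.1165, Thm. 5.4 (ii)+(iv) (arXiv Thm. 31, p. 18).
* J. Leray, Acta Math. 63 (1934), §III §19 (local regular solutions) — the statement discharged.
-/

noncomputable section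

open MeasureTheory Set Function Filter Topology
open scoped ENNReal NNReal ContDiff

namespace Literature.Analysis.FluidPDE

/-- **Tao's Thm. 5.4 (ii)+(iv) gives local classical Leray–Hopf solutions for Clay data**:
`NS.tao2011_smooth_local_existence → Fluid.local_classical_lerayHopf`. For `ν > 0` and `u₀`
smooth, divergence free and rapidly decaying, `u₀ ∈ H^∞` with finite
`A = ‖u₀‖²_{L²} + ‖∇u₀‖²_{L²}`; Tao's theorem on `[0, T]`, `T = c ν³ / (A² + 1)`, yields a classical
solution on the closed slab (a fortiori on `[0, T)`) with `u(0) = u₀`, which is Leray–Hopf on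
`[0, T]` by `isLerayHopfOn_of_hasBoundedSobolevNormsOn`. [cite: Tao2011, Thm. 5.4 (ii)+(iv)] -/
theorem local_classical_lerayHopf_of_tao (hE : tao2011_smooth_local_existence) :
    FluidPDE.local_classical_lerayHopf := by
  intro ν hν u₀ hsm hdiv hdec
  obtain ⟨c, hc, hloc⟩ := hE
  have hHinf : ∀ n : ℕ, ∫⁻ x, ‖iteratedFDeriv ℝ n u₀ x‖ₑ ^ 2 < ⊤ :=
    hdec.lintegral_enorm_iteratedFDeriv_sq_lt_top
  have h0 : ∫⁻ x, ‖u₀ x‖ₑ ^ 2 < ⊤ := by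
    refine lt_of_le_of_lt (le_of_eq (lintegral_congr fun x => ?_)) (hHinf 0)
    rw [← ofReal_norm, ← ofReal_norm, norm_iteratedFDeriv_zero]
  have h1 : ∫⁻ x, ENNReal.ofReal (FluidPDE.frobeniusNormSq (fderiv ℝ u₀ x)) < ⊤ := by
    refine lt_of_le_of_lt ?_ (ENNReal.mul_lt_top (by simp : (3 : ℝ≥0∞) < ⊤) (hHinf 1))
    calc ∫⁻ x, ENNReal.ofReal (FluidPDE.frobeniusNormSq (fderiv ℝ u₀ x))
        ≤ ∫⁻ x, 3 * ‖iteratedFDeriv ℝ 1 u₀ x‖ₑ ^ 2 := lintegral_mono fun x => by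
          rw [← ofReal_norm, norm_iteratedFDeriv_one, ofReal_norm]
          exact ofReal_frobeniusNormSq_le_three_mul_enorm_sq _
      _ = 3 * ∫⁻ x, ‖iteratedFDeriv ℝ 1 u₀ x‖ₑ ^ 2 := lintegral_const_mul' _ _ (by simp)
  set A : ℝ := ((∫⁻ x, ‖u₀ x‖ₑ ^ 2) +
    ∫⁻ x, ENNReal.ofReal (FluidPDE.frobeniusNormSq (fderiv ℝ u₀ x))).toReal with hA
  have hA0 : 0 ≤ A := ENNReal.toReal_nonneg
  have hAeq : (∫⁻ x, ‖u₀ x‖ₑ ^ 2) + ∫⁻ x, ENNReal.ofReal (FluidPDE.frobeniusNormSq (fderiv ℝ u₀ x))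
      ≤ ENNReal.ofReal A := by
    rw [hA, ENNReal.ofReal_toReal (ENNReal.add_ne_top.2 ⟨h0.ne, h1.ne⟩)]
  set T : ℝ := c * ν ^ 3 / (A ^ 2 + 1) with hT
  have hTpos : 0 < T := by positivity
  have hTc : A ^ 2 * T ≤ c * ν ^ 3 := by
    calc A ^ 2 * T = c * ν ^ 3 * (A ^ 2 / (A ^ 2 + 1)) := by rw [hT]; ring
      _ ≤ c * ν ^ 3 * 1 :=
          mul_le_mul_of_nonneg_left (by rw [div_le_one (by positivity)]; linarith) (by positivity)
      _ = c * ν ^ 3 := mul_one _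
  have hdiv' : VectorCalculus.IsDivFree u₀ := fun x => hdiv x
  obtain ⟨u, p, hsol, hu0, hub, -, hpb, huc⟩ := hloc hν hTpos hsm hdiv' hHinf hA0 hAeq hTc
  refine ⟨T, hTpos, u, p, hsol.mono Ico_subset_Icc_self (uniqueDiffOn_Ico 0 T), hu0, ?_⟩
  rw [← hu0]
  exact isLerayHopfOn_of_hasBoundedSobolevNormsOn hTpos hsol hub hpb huc

end Literature.Analysis.FluidPDE

end
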